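import Mathlib.LinearAlgebra.Matrix.Adjugate
import Mathlib.LinearAlgebra.Matrix.MvPolynomial
import Literature.Computability.AlgebraicComplexity.GrenetEquivariant
import Literature.Computability.AlgebraicComplexity.DeterminantalComplexityProofs
import Literature.Computability.AlgebraicComplexity.AlperBogartVelascoSubspace
import Literature.Computability.AlgebraicComplexity.AlperBogartVelascoBoxThree
import HarnessLib

/-!
# Grenet's representation is a Valiant projection: `pdc(PER_n) ≤ 2ⁿ - 1`, and `pdc(PER₃) = 7`

Grenet's `(2ⁿ - 1) × (2ⁿ - 1)` matrix for the permanent (Grenet 2011, Thm. 1; named in the tree as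
`Grenet.repr k n e`, with `Grenet.isAffineDetRepr_repr : det = PER_n`) has entries `0`, `±1`,
`± X (j, c)`, the common sign being `(-1) ^ (e univ + e ∅)` for the chosen enumeration
`e : Finset (Fin n) ≃ Fin 2ⁿ` of the vertices.  Choosing `e ∅ = 0`, `e univ = last` makes that
exponent `2ⁿ - 1`, odd, so EVERY cell is a single variable or a constant (`0` or `-1`): the matrix is
a projection of `DET_{2ⁿ-1}` in Valiant's sense (Valiant 1979, §2; Bürgisser 2000, §2.5), whence
`detProjectionComplexity (perPoly (Fin n) k) ≤ 2 ^ n - 1` over any nontrivial commutative ring.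

Combined with the lower half of Alper–Bogart–Velasco 2017, Cor. 1.4 (`dc(PER₃) ≥ 7` over `ℂ`,
assembled from the tree's sorry-free `AlperBogartVelasco.exists_subspace_of_isAffineDetRepr_perPoly`
and `finrank_le_three_of_subperm_two_vanish`, exactly as in the deciding theorem of route
`ValiantsHypothesis/ProjectionRigidity`) and `dc ≤ pdc`, this pins the first value of Valiant's
measure beyond `pdc(PER₁) = 1`, `pdc(PER₂) = 3`: `pdc(PER₃) = 7 = 2³ - 1`.

## Sources
* B. Grenet, *An upper bound for the permanent versus determinant problem* (2011), Thm. 1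
  (key `Grenet2011`).
* L. G. Valiant, *Completeness classes in algebra*, STOC 1979, §2 (key `Valiant1979`).
* J. Alper, T. Bogart, M. Velasco, *A lower bound for the determinantal complexity of a
  hypersurface*, FoCM 17 (2017), Cor. 1.4 (key `AlperBogartVelasco2017`).
-/

noncomputable section

open MvPolynomial Matrix Finset

namespace Literature.Computability.AlgebraicComplexity

namespace Grenet

section Cells

variable (k : Type*) [CommRing k] (n : ℕ)

/-- Grenet's branching program has no arc `S → S`: the diagonal of its adjacency matrix vanishes.
[cite: Grenet2011, Thm. 1] -/
theorem adj_apply_self (S : Finset (Fin n)) : adj k n S S = 0 := by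
  rw [adj_apply]
  refine sum_eq_zero fun j _ => if_neg ?_
  rintro ⟨hj, hS⟩
  have hmem : j ∈ insert j S := mem_insert_self j S
  rw [← hS] at hmem
  exact hj hmem

/-- Every entry of Grenet's adjacency matrix is `0` or a single variable `X (j, |S|)` (the arc
`S → insert j S`, `j ∉ S`, determines `j`). [cite: Grenet2011, Thm. 1] -/
theorem adj_apply_eq_zero_or_eq_X (S T : Finset (Fin n)) :
    adj k n S T = 0 ∨ ∃ v, adj k n S T = X v := by
  by_cases h : ∃ j, j ∉ S ∧ T = insert j S
  · obtain ⟨j, hj, rfl⟩ := h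
    refine Or.inr ⟨(j, ⟨S.card, card_lt_of_notMem hj⟩), ?_⟩
    rw [adj_apply, Fintype.sum_eq_single j]
    · rw [if_pos ⟨hj, rfl⟩, wt, dif_pos (card_lt_of_notMem hj)]
    · intro j' hj'
      refine if_neg ?_
      rintro ⟨hj'S, hins⟩
      have hmem : j' ∈ insert j' S := mem_insert_self j' S
      rw [← hins] at hmem
      rcases mem_insert.mp hmem with h | h
      · exact hj' h
      · exact hj'S h
  · refine Or.inl ?_
    rw [adj_apply]
    exact sum_eq_zero fun j _ => if_neg fun hj => h ⟨j, hj⟩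

variable {k n}

/-- When `e univ + e ∅` is odd, Grenet's matrix is `adj - 1` restricted to the minor, so every cell is
a single variable or a constant (`0` or `-1`): it is a projection matrix in Valiant's sense.
[cite: Grenet2011, Thm. 1] -/
theorem repr_apply_isPure {N : ℕ} (e : Finset (Fin n) ≃ Fin (N + 1))
    (he : Odd ((e univ : ℕ) + (e ∅ : ℕ))) (p q : Fin N) :
    (∃ v, repr k n e p q = X v) ∨ ∃ c, repr k n e p q = C c := by
  have hrepr : repr k n e p q =
      adj k n (e.symm ((e univ).succAbove p)) (e.symm ((e ∅).succAbove q)) -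
        (1 : Matrix (Finset (Fin n)) (Finset (Fin n)) (MvPolynomial (Fin n × Fin n) k))
          (e.symm ((e univ).succAbove p)) (e.symm ((e ∅).succAbove q)) := by
    rw [repr, Matrix.smul_apply, smul_eq_mul, he.neg_one_pow, Matrix.submatrix_apply,
      Matrix.submatrix_apply, Matrix.sub_apply]
    ring
  rw [hrepr]
  by_cases hST : e.symm ((e univ).succAbove p) = e.symm ((e ∅).succAbove q)
  · refine Or.inr ⟨-1, ?_⟩
    rw [hST, adj_apply_self, Matrix.one_apply_eq, map_neg, map_one, zero_sub]
  · rw [Matrix.one_apply_ne hST, sub_zero]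
    rcases adj_apply_eq_zero_or_eq_X k n (e.symm ((e univ).succAbove p))
        (e.symm ((e ∅).succAbove q)) with h | ⟨v, hv⟩
    · exact Or.inr ⟨0, by rw [h, map_zero]⟩
    · exact Or.inl ⟨v, hv⟩

/-- For `n ≠ 0` the subsets of `Fin n` can be enumerated with `∅ ↦ 0` and `univ ↦ last`
(two transpositions after any enumeration). [folklore] -/
theorem exists_equiv_empty_univ (hn : n ≠ 0) {N : ℕ} (hN : 2 ^ n = N + 1) :
    ∃ e : Finset (Fin n) ≃ Fin (N + 1), e ∅ = 0 ∧ e univ = Fin.last N := by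
  have hcard : Fintype.card (Finset (Fin n)) = N + 1 := by
    rw [Fintype.card_finset, Fintype.card_fin, hN]
  obtain ⟨e₀⟩ : Nonempty (Finset (Fin n) ≃ Fin (N + 1)) := ⟨Fintype.equivFinOfCardEq hcard⟩
  have hne : (∅ : Finset (Fin n)) ≠ univ := by
    intro h
    have h1 := congrArg Finset.card h
    rw [Finset.card_empty, Finset.card_univ, Fintype.card_fin] at h1
    exact hn h1.symm
  have hN0 : N ≠ 0 := by
    have := Nat.one_lt_two_pow hn
    omega
  have he₁ : (e₀.trans (Equiv.swap (e₀ ∅) 0)) ∅ = 0 := by simp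
  refine ⟨(e₀.trans (Equiv.swap (e₀ ∅) 0)).trans
      (Equiv.swap ((e₀.trans (Equiv.swap (e₀ ∅) 0)) univ) (Fin.last N)), ?_, by simp⟩
  rw [Equiv.trans_apply, he₁]
  refine Equiv.swap_apply_of_ne_of_ne ?_ ?_
  · exact fun h => hne ((e₀.trans (Equiv.swap (e₀ ∅) 0)).injective (he₁.trans h))
  · intro h
    have h1 := congrArg Fin.val h
    rw [Fin.val_zero, Fin.val_last] at h1
    exact hN0 h1.symm

end Cells

end Grenet

/-- **Grenet's representation is a Valiant projection** (Grenet 2011, Thm. 1, in the projection model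
of Valiant 1979, §2): for `n ≠ 0` the generic `n × n` permanent is a projection of `DET_{2ⁿ - 1}` —
every cell of `Grenet.repr k n e` (with `e ∅ = 0`, `e univ = last`) is a variable or one of the
constants `0`, `-1`. Any nontrivial commutative ring. [cite: Grenet2011, Thm. 1] -/
theorem isDetProjection_perPoly_grenet (k : Type*) [CommRing k] [Nontrivial k] {n : ℕ}
    (hn : n ≠ 0) : IsDetProjection (perPoly (Fin n) k) (2 ^ n - 1) := by
  obtain ⟨N, hN⟩ : ∃ N, 2 ^ n = N + 1 := ⟨2 ^ n - 1, by have := @Nat.one_le_two_pow n; omega⟩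
  rw [hN, Nat.add_sub_cancel]
  obtain ⟨e, he0, heu⟩ := Grenet.exists_equiv_empty_univ hn hN
  have hodd : Odd ((e univ : ℕ) + (e ∅ : ℕ)) := by
    rw [he0, heu, Fin.val_last, Fin.val_zero, add_zero]
    have h2 : Even (N + 1) := hN ▸ Nat.even_pow.mpr ⟨even_two, hn⟩
    exact Nat.not_even_iff_odd.mp (Nat.even_add_one.mp h2)
  obtain ⟨-, hdet⟩ := Grenet.isAffineDetRepr_repr k n hn hN e
  refine ⟨fun p => Grenet.repr k n e p.1 p.2, fun p => Grenet.repr_apply_isPure e hodd p.1 p.2, ?_⟩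
  have hmap : (aeval fun p : Fin N × Fin N => Grenet.repr k n e p.1 p.2).mapMatrix
      (mvPolynomialX (Fin N) (Fin N) k) = Grenet.repr k n e := by
    ext i j
    simp [Matrix.mvPolynomialX_apply]
  rw [detPoly, AlgHom.map_det, hmap]
  exact hdet.symm

/-- **Grenet's upper bound in Valiant's projection measure**: `pdc(PER_n) ≤ 2ⁿ - 1` (`n ≠ 0`, any
nontrivial commutative ring) (Grenet 2011, Thm. 1; Bürgisser 2000, §2.5). [cite: Grenet2011, Thm. 1] -/
theorem detProjectionComplexity_perPoly_le_grenet (k : Type*) [CommRing k] [Nontrivial k] {n : ℕ}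
    (hn : n ≠ 0) : detProjectionComplexity (perPoly (Fin n) k) ≤ 2 ^ n - 1 :=
  Nat.sInf_le (isDetProjection_perPoly_grenet k hn)

/-- Hence `pdc(PER_n) = 2ⁿ - 1` as soon as `2ⁿ - 1 ≤ pdc(PER_n)` (the conjectural optimality of
Grenet's construction among projections; known for `n ≤ 3`). [folklore] -/
theorem detProjectionComplexity_perPoly_eq_of_le (k : Type*) [CommRing k] [Nontrivial k] {n : ℕ}
    (hn : n ≠ 0) (h : 2 ^ n - 1 ≤ detProjectionComplexity (perPoly (Fin n) k)) :
    detProjectionComplexity (perPoly (Fin n) k) = 2 ^ n - 1 :=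
  le_antisymm (detProjectionComplexity_perPoly_le_grenet k hn) h

/-- **`dc(PER₃) ≥ 7` over `ℂ`** — the lower half of Alper–Bogart–Velasco 2017, Cor. 1.4, assembled
from the tree's sorry-free pieces: an affine representation of `PER₃` of size `dc` yields a linear
subspace of dimension `≥ 10 - dc` on which all `2 × 2` sub-permanents (the first partials) vanish,
and such a subspace has dimension `≤ 3`. [cite: AlperBogartVelasco2017, Cor. 1.4] -/
theorem seven_le_determinantalComplexity_perPoly_three :
    7 ≤ determinantalComplexity (perPoly (Fin 3) ℂ) := by
  have h2 : (2 : ℂ) ≠ 0 := two_ne_zero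
  obtain ⟨A, hA⟩ := hasDetRepr_determinantalComplexity_holds (perPoly (Fin 3) ℂ)
  obtain ⟨W, hW, hvan⟩ :=
    AlperBogartVelasco.exists_subspace_of_isAffineDetRepr_perPoly h2 le_rfl hA
  have hfin : Module.finrank ℂ W ≤ 3 := by
    refine AlperBogartVelasco.finrank_le_three_of_subperm_two_vanish W fun x hx r c => ?_
    have key : MvPolynomial.eval x (MvPolynomial.pderiv (r, c) (perPoly (Fin 3) ℂ)) =
        ((Matrix.of fun i j => x (i, j)).submatrix r.succAbove c.succAbove).permanent := by
      rw [VonZurGathen.pderiv_perPoly, ← MvPolynomial.aeval_eq_eval, VonZurGathen.aeval_subperm_X,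
        Matrix.subperm_eq_permanent_of_equiv _ (finSuccAboveEquiv c) (finSuccAboveEquiv r)]
      rfl
    rw [← key]
    exact hvan x hx (r, c)
  norm_num at hW ⊢
  omega

/-- **`pdc(PER₃) = 7`**: Grenet's 7 × 7 projection is optimal among Valiant projections of the
determinant for the `3 × 3` permanent over `ℂ` (`7 ≤ dc(PER₃) ≤ pdc(PER₃) ≤ 2³ - 1`;
Alper–Bogart–Velasco 2017, Cor. 1.4 with Grenet 2011, Thm. 1). [cite: AlperBogartVelasco2017, Cor. 1.4] -/
theorem detProjectionComplexity_perPoly_three :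
    detProjectionComplexity (perPoly (Fin 3) ℂ) = 7 := by
  refine le_antisymm (detProjectionComplexity_perPoly_le_grenet ℂ (by norm_num)) ?_
  exact seven_le_determinantalComplexity_perPoly_three.trans
    (determinantalComplexity_le_detProjectionComplexity_holds _)

end Literature.Computability.AlgebraicComplexity
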